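import Summits.AtomisticToContinuum.FouriersLaw.Theorems.JunctionLocalityNonBallisticStubMidpointContraction
import Summits.AtomisticToContinuum.FouriersLaw.Theorems.BondHeatUncertaintySubdiffusiveBondHeatKernelGibbsD
import Mathlib.Analysis.Convex.Integral
import Mathlib.Analysis.Convex.SpecificFunctions.Basic

/-!
# `NonBallistic` / line `contact-current-forgetting`: the contraction profile is antitone

Helper file (`--supports stmt-AtomisticToContinuum-9127`) for the line's central object, the contraction profile
`φ_N(s) = ‖κ_s j_0‖²_{L²(μ_T)} + ‖κ_s j_{N-2}‖²_{L²(μ_T)}` (`contactProfile`, `Theorems/JunctionLocalityDefs.lean`):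

* `pinnedChain_integral_sq_integral_le` — **`L²(μ_T)`-contraction of the equal-temperature kernels for GENERAL `L²`
  observables**: for measurable `f` with `f² ∈ L¹(μ_T)`, `(κ_u f)² ∈ L¹(μ_T)` and `∫ (κ_u f)² dμ_T ≤ ∫ f² dμ_T` (a.e.
  Jensen for the Markov kernel — `f² ∈ L¹(κ_u(z,·))` for `μ_T`-a.e. `z` by `Measure.lintegral_bind` and Gibbs invariance
  `pinnedChain_gibbsMeasure_bind_transitionKernel` — then invariance again; the tree's `pinnedChain_integral_sq_act_le`
  covers only continuous `e^{ϑH}`-dominated `f`);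
* `contactProfile_antitone` — `φ_N(u) ≤ φ_N(s)` for `0 ≤ s ≤ u` (Chapman–Kolmogorov `κ_u = κ_s ∘ (κ_{u-s} first)` and the
  contraction applied to `f = κ_s j`), for every `N ≥ 1`.

Consequences used downstream: the registered stub `stub_uniformContactForgetting` (uniformly small tails of `φ_N`) follows
from any `N`-uniform pointwise decay bound, and `φ_N(s) ≤ φ_N(0) = μ_T(j_0²) + μ_T(j_{N-2}²)`.
-/

noncomputable section

namespace Summit.AtomisticToContinuum.FouriersLaw.Theorems.NonBallistic

open MeasureTheory ProbabilityTheory Set Filter Topology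
open scoped NNReal ENNReal
open Literature.MathematicalPhysics.KineticTheory.HeatConduction
open Summit.AtomisticToContinuum.FouriersLaw.Theorems.JunctionLocality
open Summit.AtomisticToContinuum.FouriersLaw.Theorems.SubdiffusiveBondHeat

namespace ProfileAntitone

variable {ω₂ lam β γ : ℝ} (hω : 0 < ω₂) (hl : 0 ≤ lam) (hβ : 0 < β) (hγ : 0 < γ) {N : ℕ} (hN : 0 < N)
  {T : ℝ} (hT : 0 < T)

/-- `ofReal (∫ f) ≤ ∫⁻ ofReal f` for an a.e. nonnegative `f` (no integrability needed: the junk value is `0`). -/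
theorem ofReal_integral_le_lintegral_ofReal' {α : Type*} [MeasurableSpace α] {ν : Measure α} {f : α → ℝ}
    (f_nn : 0 ≤ᵐ[ν] f) : ENNReal.ofReal (∫ x, f x ∂ν) ≤ ∫⁻ x, ENNReal.ofReal (f x) ∂ν := by
  by_cases hfi : Integrable f ν
  · rw [ofReal_integral_eq_lintegral_ofReal hfi f_nn]
  · rw [integral_undef hfi]; simp

/-- Jensen for a probability measure: `(∫ f)² ≤ ∫ f²` when `f` and `f²` are integrable. -/
theorem sq_integral_le_integral_sq {α : Type*} [MeasurableSpace α] {ν : Measure α} [IsProbabilityMeasure ν]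
    {f : α → ℝ} (hf : Integrable f ν) (hf2 : Integrable (fun y => f y ^ 2) ν) :
    (∫ y, f y ∂ν) ^ 2 ≤ ∫ y, f y ^ 2 ∂ν := by
  have hconv : ConvexOn ℝ Set.univ fun x : ℝ => x ^ 2 := Even.convexOn_pow even_two
  exact hconv.map_integral_le (continuousOn_pow 2) isClosed_univ (ae_of_all _ fun _ => mem_univ _) hf hf2

include hω hl hβ hγ hN hT in
/-- **`L²(μ_T)`-contraction of the transition kernels for general `L²` observables.** For measurable `f` with
`f² ∈ L¹(μ_T)`: `z ↦ (∫ f dκ_u(z,·))²` is `μ_T`-integrable and `∫ (∫ f dκ_u(z,·))² dμ_T(z) ≤ ∫ f² dμ_T`. -/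
theorem pinnedChain_integral_sq_integral_le {f : PhaseSpace N → ℝ} (hf : Measurable f)
    (hf2 : Integrable (fun y => f y ^ 2) ((pinnedChain ω₂ lam β γ).gibbsMeasure N T)) (u : ℝ≥0) :
    Integrable (fun z => (∫ y, f y ∂((pinnedChain ω₂ lam β γ).transitionKernel N T T u z)) ^ 2)
        ((pinnedChain ω₂ lam β γ).gibbsMeasure N T) ∧
      ∫ z, (∫ y, f y ∂((pinnedChain ω₂ lam β γ).transitionKernel N T T u z)) ^ 2
          ∂((pinnedChain ω₂ lam β γ).gibbsMeasure N T) ≤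
        ∫ y, f y ^ 2 ∂((pinnedChain ω₂ lam β γ).gibbsMeasure N T) := by
  set P := pinnedChain ω₂ lam β γ with hP
  set μ := P.gibbsMeasure N T with hμ
  set κ := P.transitionKernel N T T u with hκ
  haveI : IsProbabilityMeasure μ := pinnedChain_isProbabilityMeasure_gibbsMeasure hω hl hβ.le γ N hT
  haveI : IsMarkovKernel κ := pinnedChain_isMarkovKernel_transitionKernel hω hl hβ.le hγ.le N T T u
  have hinv : μ.bind κ = μ := pinnedChain_gibbsMeasure_bind_transitionKernel hω hl hβ.le hγ.le hN hT u
  have hf2m : Measurable fun y => f y ^ 2 := hf.pow_const 2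
  have hf2e : Measurable fun y => ENNReal.ofReal (f y ^ 2) := hf2m.ennreal_ofReal
  -- the iterated lintegral of f² is finite (invariance), so f² ∈ L¹(κ z) for a.e. z
  have hlin : ∫⁻ z, ∫⁻ y, ENNReal.ofReal (f y ^ 2) ∂κ z ∂μ = ∫⁻ y, ENNReal.ofReal (f y ^ 2) ∂μ := by
    rw [← Measure.lintegral_bind κ.measurable.aemeasurable hf2e.aemeasurable, hinv]
  have hfin : ∫⁻ y, ENNReal.ofReal (f y ^ 2) ∂μ < ∞ := by
    have := hf2.hasFiniteIntegral
    rw [HasFiniteIntegral] at this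
    refine lt_of_le_of_lt (lintegral_mono fun y => ?_) this
    rw [Real.enorm_eq_ofReal (sq_nonneg _)]
  have hmeasL : Measurable fun z => ∫⁻ y, ENNReal.ofReal (f y ^ 2) ∂κ z := hf2e.lintegral_kernel
  have hae : ∀ᵐ z ∂μ, ∫⁻ y, ENNReal.ofReal (f y ^ 2) ∂κ z < ∞ :=
    ae_lt_top hmeasL (by rw [hlin]; exact hfin.ne)
  have hint2 : ∀ᵐ z ∂μ, Integrable (fun y => f y ^ 2) (κ z) := by
    filter_upwards [hae] with z hz
    refine ⟨hf2m.aestronglyMeasurable, ?_⟩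
    rw [HasFiniteIntegral]
    refine lt_of_le_of_lt (lintegral_mono fun y => ?_) hz
    rw [Real.enorm_eq_ofReal (sq_nonneg _)]
  have hint1 : ∀ᵐ z ∂μ, Integrable f (κ z) := by
    filter_upwards [hint2] with z hz
    exact ((memLp_two_iff_integrable_sq hf.aestronglyMeasurable).2 hz).integrable one_le_two
  -- the dominating function g z = ∫ f² dκ z is μ-integrable with ∫ g dμ = ∫ f² dμ
  set g : PhaseSpace N → ℝ := fun z => ∫ y, f y ^ 2 ∂κ z with hg
  have hg0 : ∀ z, 0 ≤ g z := fun z => integral_nonneg fun _ => sq_nonneg _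
  have hgm : StronglyMeasurable g :=
    (hf2m.stronglyMeasurable.comp_measurable measurable_snd).integral_kernel_prod_right'
  have hgint : Integrable g μ := by
    refine ⟨hgm.aestronglyMeasurable, ?_⟩
    rw [HasFiniteIntegral]
    calc ∫⁻ z, ‖g z‖ₑ ∂μ = ∫⁻ z, ENNReal.ofReal (g z) ∂μ :=
          lintegral_congr fun z => Real.enorm_eq_ofReal (hg0 z)
      _ ≤ ∫⁻ z, ∫⁻ y, ENNReal.ofReal (f y ^ 2) ∂κ z ∂μ :=
          lintegral_mono fun z => ofReal_integral_le_lintegral_ofReal' (ae_of_all _ fun _ => sq_nonneg _)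
      _ = ∫⁻ y, ENNReal.ofReal (f y ^ 2) ∂μ := hlin
      _ < ∞ := hfin
  have hgval : ∫ z, g z ∂μ = ∫ y, f y ^ 2 ∂μ :=
    pinnedChain_integral_transitionKernel_gibbsMeasure hω hl hβ.le hγ.le hN hT u hf2
  -- a.e. Jensen
  have hjensen : ∀ᵐ z ∂μ, (∫ y, f y ∂κ z) ^ 2 ≤ g z := by
    filter_upwards [hint1, hint2] with z h1 h2
    exact sq_integral_le_integral_sq h1 h2
  have hFm : StronglyMeasurable fun z => (∫ y, f y ∂κ z) ^ 2 :=
    ((hf.stronglyMeasurable.comp_measurable measurable_snd).integral_kernel_prod_right').pow 2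
  have hFint : Integrable (fun z => (∫ y, f y ∂κ z) ^ 2) μ := by
    refine hgint.mono' hFm.aestronglyMeasurable ?_
    filter_upwards [hjensen] with z hz
    rw [Real.norm_eq_abs, abs_of_nonneg (sq_nonneg _)]
    exact hz
  refine ⟨hFint, ?_⟩
  calc ∫ z, (∫ y, f y ∂κ z) ^ 2 ∂μ ≤ ∫ z, g z ∂μ := integral_mono_ae hFint hgint hjensen
    _ = ∫ y, f y ^ 2 ∂μ := hgval

include hω hl hβ hγ hN hT in
/-- One contact: `s ↦ ‖κ_{s⁺} j_b‖²_{L²(μ_T)}` is antitone on `[0,∞)`. -/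
theorem integral_sq_evolve_antitone (b : ℕ) {s u : ℝ} (hs : 0 ≤ s) (hsu : s ≤ u) :
    ∫ z, (evolve (pinnedChain ω₂ lam β γ) N T (bondCurrentAt (pinnedChain ω₂ lam β γ) N b) u z) ^ 2
        ∂((pinnedChain ω₂ lam β γ).gibbsMeasure N T) ≤
      ∫ z, (evolve (pinnedChain ω₂ lam β γ) N T (bondCurrentAt (pinnedChain ω₂ lam β γ) N b) s z) ^ 2
        ∂((pinnedChain ω₂ lam β γ).gibbsMeasure N T) := by
  set P := pinnedChain ω₂ lam β γ with hP
  set s' : ℝ≥0 := s.toNNReal with hs'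
  set d' : ℝ≥0 := (u - s).toNNReal with hd'
  have hud : u.toNNReal = d' + s' := by
    rw [hd', hs', ← Real.toNNReal_add (by linarith) hs]; congr 1; ring
  -- facts for f = κ_{s'} j_b
  obtain ⟨-, hf2, -, hfm, -⟩ := MidpointContraction.evolve_facts hω hl hβ hγ hN hT b s'
  obtain ⟨-, -, -, -, hjκ⟩ := MidpointContraction.evolve_facts hω hl hβ hγ hN hT b (d' + s')
  -- Chapman–Kolmogorov: κ_{u} j = κ_{d'} (κ_{s'} j)
  have hCK : ∀ z, evolve P N T (bondCurrentAt P N b) u z =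
      ∫ y, (fun y => ∫ y', bondCurrentAt P N b y' ∂(P.transitionKernel N T T s' y)) y
        ∂(P.transitionKernel N T T d' z) := by
    intro z
    unfold evolve
    rw [hud, pinnedChain_transitionKernel_add hω hl hβ.le hγ.le N T T d' s', Kernel.integral_comp]
    rw [← pinnedChain_transitionKernel_add hω hl hβ.le hγ.le N T T d' s']
    exact hjκ z
  have hlhs : ∫ z, (evolve P N T (bondCurrentAt P N b) u z) ^ 2 ∂(P.gibbsMeasure N T) =
      ∫ z, (∫ y, (fun y => ∫ y', bondCurrentAt P N b y' ∂(P.transitionKernel N T T s' y)) y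
        ∂(P.transitionKernel N T T d' z)) ^ 2 ∂(P.gibbsMeasure N T) :=
    integral_congr_ae (ae_of_all _ fun z => by simp only [hCK z])
  rw [hlhs]
  exact (pinnedChain_integral_sq_integral_le hω hl hβ hγ hN hT hfm.measurable hf2 d').2

end ProfileAntitone

open ProfileAntitone in
/-- **The contraction profile is antitone** (line `contact-current-forgetting`, crux stmt-AtomisticToContinuum-9127): for
the pinned chain (all parameters positive), `T > 0`, `N ≥ 1` and `0 ≤ s ≤ u`, `φ_N(u) ≤ φ_N(s)` — predictability of the
contact currents only decreases with the horizon (Chapman–Kolmogorov + `L²(μ_T)`-contraction of the Gibbs-invariant kernels). -/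
theorem contactProfile_antitone :
    ∀ ω₂ lam β γ : ℝ, 0 < ω₂ → 0 < lam → 0 < β → 0 < γ → ∀ T : ℝ, 0 < T → ∀ N : ℕ, 1 ≤ N →
      ∀ s u : ℝ, 0 ≤ s → s ≤ u →
        contactProfile (pinnedChain ω₂ lam β γ) N T u ≤ contactProfile (pinnedChain ω₂ lam β γ) N T s := by
  intro ω₂ lam β γ hω hl hβ hγ T hT N hN s u hs hsu
  have hN0 : 0 < N := hN
  obtain ⟨-, hu0, -, -, -⟩ := MidpointContraction.evolve_facts hω hl.le hβ hγ hN0 hT 0 u.toNNReal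
  obtain ⟨-, huN, -, -, -⟩ := MidpointContraction.evolve_facts hω hl.le hβ hγ hN0 hT (N - 2) u.toNNReal
  obtain ⟨-, hs0, -, -, -⟩ := MidpointContraction.evolve_facts hω hl.le hβ hγ hN0 hT 0 s.toNNReal
  obtain ⟨-, hsN, -, -, -⟩ := MidpointContraction.evolve_facts hω hl.le hβ hγ hN0 hT (N - 2) s.toNNReal
  have h0 := integral_sq_evolve_antitone hω hl.le hβ hγ hN0 hT 0 hs hsu
  have hN2 := integral_sq_evolve_antitone hω hl.le hβ hγ hN0 hT (N - 2) hs hsu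
  unfold contactProfile
  unfold evolve at h0 hN2 ⊢
  rw [integral_add hu0 huN, integral_add hs0 hsN]
  exact add_le_add h0 hN2

/-- Corollary: `φ_N(s) ≤ φ_N(0) = μ_T(j_0²) + μ_T(j_{N-2}²)` for `s ≥ 0` — the profile never exceeds the static second
moments of the two contact currents. -/
theorem contactProfile_le_zero :
    ∀ ω₂ lam β γ : ℝ, 0 < ω₂ → 0 < lam → 0 < β → 0 < γ → ∀ T : ℝ, 0 < T → ∀ N : ℕ, 1 ≤ N →
      ∀ s : ℝ, 0 ≤ s →
        contactProfile (pinnedChain ω₂ lam β γ) N T s ≤ contactProfile (pinnedChain ω₂ lam β γ) N T 0 :=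
  fun ω₂ lam β γ hω hl hβ hγ T hT N hN s hs =>
    contactProfile_antitone ω₂ lam β γ hω hl hβ hγ T hT N hN 0 s le_rfl hs

end Summit.AtomisticToContinuum.FouriersLaw.Theorems.NonBallistic

end
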